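import Mathlib
import HarnessLib
import Summits.QuantumAdvantage.QuantumAdvantage.Theorems.DigitDialE
import Summits.QuantumAdvantage.QuantumAdvantage.Theorems.DigitDialI

set_option linter.dupNamespace false
set_option autoImplicit false

/-!
# DigitDial (J) — JUNTA ⊕ YOUNG-SYMMETRIC low-degree strategies are of polylog LINEAR RANK, hence lose — with NO block-size
# hypothesis (cell decomp-qadv, lens 4, g20 rev 5)

Prop-definition-free tree twin of §9c of the lens-4 g20 node `DigitDial`.
* `juntaYoung_eq_linStrat` — a strategy all of whose output bits have `𝔽_p`-degree `d < p^K` and are symmetric on each of `B`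
  pairwise disjoint blocks (disjoint from a junta `J`, covering `Jᶜ`; ARBITRARY on `J`) IS `linStrat lam tab` for `B + |J|`
  linear forms mod `p^K` (block-weight forms + junta coordinate forms; window-Lucas `DigitDialE.blockSymm_factor` on the refined
  partition);
* `juntaYoung_card_win_le_polylog` — for every prime `p ≠ 3` and `C`, for `n ≥ n₀`: every such strategy with `|J| + B ≤ (log₂ n)^C`
  and degree `≤ (log₂ n)^C` wins the u-walk game (any charge) on `≤ (7/8)·2ⁿ` — WHATEVER THE BLOCK SIZES (strictly stronger than
  `DigitDialG.youngJunta_card_win_le_fin`, which needs blocks `≥ 4p^{2K}((|J|+B)p^K+4)`): `DigitDialI.linRank_card_win_le_polylog`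
  at `C + 1` (`p^K ≤ p·(log₂ n)^C ≤ (log₂ n)^{C+1}` once `n ≥ 2^p`).
0 sorry; axioms standard; no `instance`, no `notation`, no `native_decide`; no `def … : Prop`.
-/

noncomputable section

namespace Summit.QuantumAdvantage.QuantumAdvantage.Theorems.DigitDial

open Finset Summit.QuantumAdvantage.AdviceFreeQNC0 Literature.Computability.MetaComplexity
open TwistedTransfer ConstBells

section JuntaYoungRank

variable {n : ℕ}

/-- A junta ⊕ Young-symmetric strategy of degree `< p^K` IS a strategy of linear rank `B + |J|` mod `p^K` (the block forms and
the coordinate forms of the junta, by window-Lucas on the refined partition). [bookkeeping] -/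
theorem juntaYoung_eq_linStrat {p : ℕ} [hp : Fact p.Prime] {d K B : ℕ} (J : Finset (Fin n)) (hd : d < p ^ K)
    (W : Fin B → Finset (Fin n)) (hdisj : ∀ b b', b ≠ b' → Disjoint (W b) (W b')) (hWJ : ∀ b, Disjoint (W b) J)
    (hcover : ∀ i, i ∉ J → ∃ b, i ∈ W b) (y : Fin (n + 1) → (Fin n → Bool) → Bool)
    (hys : ∀ g b, ∀ u v : Fin n → Bool, (∀ i, i ∉ W b → u i = v i) → wtOn (W b) u = wtOn (W b) v → y g u = y g v)
    (hyd : ∀ g, HasDegF p (y g) d) :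
    ∃ (lam : Fin (B + J.card) → Fin n → ZMod (p ^ K)) (tab : Fin (n + 1) → (Fin (B + J.card) → ZMod (p ^ K)) → Bool),
      y = linStrat lam tab := by
  classical
  haveI : NeZero (p ^ K) := ⟨pow_ne_zero _ hp.out.ne_zero⟩
  set W' : Fin (B + J.card) → Finset (Fin n) :=
    Fin.append W (fun a : Fin J.card => ({(J.equivFin.symm a : Fin n)} : Finset (Fin n))) with hW'
  have hW'left : ∀ b : Fin B, W' (Fin.castAdd J.card b) = W b := fun b => by
    rw [hW']; exact Fin.append_left W _ b
  have hW'right : ∀ a : Fin J.card, W' (Fin.natAdd B a) = {(J.equivFin.symm a : Fin n)} := fun a => by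
    rw [hW']; exact Fin.append_right W _ a
  have hdisj' : ∀ k k', k ≠ k' → Disjoint (W' k) (W' k') := by
    intro k k' hkk'
    induction k using Fin.addCases with
    | left b =>
      induction k' using Fin.addCases with
      | left b' =>
        rw [hW'left, hW'left]
        exact hdisj b b' fun h => hkk' (by rw [h])
      | right a' =>
        rw [hW'left, hW'right, Finset.disjoint_singleton_right]
        exact fun h => Finset.disjoint_left.1 (hWJ b) h (J.equivFin.symm a').2
    | right a =>
      induction k' using Fin.addCases with
      | left b' =>
        rw [hW'left, hW'right, Finset.disjoint_singleton_left]
        exact fun h => Finset.disjoint_left.1 (hWJ b') h (J.equivFin.symm a).2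
      | right a' =>
        rw [hW'right, hW'right, Finset.disjoint_singleton_left, Finset.mem_singleton]
        intro h
        apply hkk'
        have : a = a' := J.equivFin.symm.injective (Subtype.ext h)
        rw [this]
  have hcover' : ∀ i, ∃ k, i ∈ W' k := by
    intro i
    by_cases hi : i ∈ J
    · refine ⟨Fin.natAdd B (J.equivFin ⟨i, hi⟩), ?_⟩
      rw [hW'right, Finset.mem_singleton]
      simp
    · obtain ⟨b, hb⟩ := hcover i hi
      exact ⟨Fin.castAdd J.card b, by rw [hW'left]; exact hb⟩
  have hys' : ∀ g k, ∀ u v : Fin n → Bool, (∀ i, i ∉ W' k → u i = v i) → wtOn (W' k) u = wtOn (W' k) v →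
      y g u = y g v := by
    intro g k u v hout hwt
    induction k using Fin.addCases with
    | left b => rw [hW'left] at hout hwt; exact hys g b u v hout hwt
    | right a =>
      rw [hW'right] at hout hwt
      have huv : u = v := by
        funext i
        by_cases hi : i = (J.equivFin.symm a : Fin n)
        · unfold wtOn at hwt
          rw [Finset.filter_singleton, Finset.filter_singleton] at hwt
          subst hi
          by_cases hu : u (J.equivFin.symm a : Fin n) = true <;>
            by_cases hv : v (J.equivFin.symm a : Fin n) = true <;> simp_all
        · exact hout i (by rwa [Finset.mem_singleton])
      rw [huv]
  choose tab htab using fun g => blockSymm_factor hd W' hdisj' hcover' (hys' g) (hyd g)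
  exact ⟨blockForm (p ^ K) W', tab, funext fun g => funext fun u => htab g u⟩

/-- **Junta ⊕ Young-symmetric strategies of degree `≤ (log₂ n)^C` lose — NO block-size hypothesis**: for every prime `p ≠ 3`
and every `C`, for `n ≥ n₀(p, C)`, every charge, every junta `J` and `B` pairwise disjoint blocks disjoint from `J` covering `Jᶜ`
with `|J| + B ≤ (log₂ n)^C`, every strategy of `𝔽_p`-degree `≤ (log₂ n)^C` whose output bits are symmetric on every block wins the
u-walk game on `≤ (7/8)·2ⁿ` inputs (`linRank_card_win_le_polylog (C+1)` + `juntaYoung_eq_linStrat`). -/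
theorem juntaYoung_card_win_le_polylog {p : ℕ} [hp : Fact p.Prime] (hp3 : p ≠ 3) (C : ℕ) :
    ∃ n₀ : ℕ, ∀ n ≥ n₀, ∀ c : ℕ, ∀ (J : Finset (Fin n)) (B : ℕ) (W : Fin B → Finset (Fin n)),
      J.card + B ≤ (Nat.log 2 n) ^ C → (∀ b b', b ≠ b' → Disjoint (W b) (W b')) → (∀ b, Disjoint (W b) J) →
      (∀ i, i ∉ J → ∃ b, i ∈ W b) →
      ∀ y : Fin (n + 1) → (Fin n → Bool) → Bool,
        (∀ g b, ∀ u v : Fin n → Bool, (∀ i, i ∉ W b → u i = v i) → wtOn (W b) u = wtOn (W b) v → y g u = y g v) →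
        (∀ g, HasDegF p (y g) ((Nat.log 2 n) ^ C)) →
          ((univ.filter fun u : Fin n → Bool => ringWinU c y u = true).card : ℝ) ≤ (7 / 8) * (2 : ℝ) ^ n := by
  obtain ⟨n₀, hn₀⟩ := linRank_card_win_le_polylog (C + 1)
  refine ⟨max n₀ (2 ^ p), fun n hn c J B W hJB hdisj hWJ hcover y hys hyd => ?_⟩
  have hnp : 2 ^ p ≤ n := le_trans (le_max_right _ _) hn
  have hp2 : 2 ≤ p := hp.out.two_le
  set L : ℕ := Nat.log 2 n with hLdef
  have hLp : p ≤ L := Nat.le_log_of_pow_le (by norm_num) hnp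
  have hL1 : 1 ≤ L := by omega
  set d : ℕ := L ^ C with hd
  have hd1 : 1 ≤ d := Nat.one_le_pow _ _ hL1
  set K : ℕ := Nat.log p d + 1 with hK
  have hdK : d < p ^ K := Nat.lt_pow_succ_log_self hp.out.one_lt d
  have hKle : p ^ K ≤ L ^ (C + 1) := by
    rw [hK, pow_succ, pow_succ]
    exact Nat.mul_le_mul (Nat.pow_log_le_self p (by omega)) hLp
  have hcop : (p ^ K).Coprime 3 :=
    Nat.Coprime.pow_left _ ((Nat.coprime_primes hp.out Nat.prime_three).2 hp3)
  obtain ⟨lam, tab, hy⟩ := juntaYoung_eq_linStrat J hdK W hdisj hWJ hcover y hys hyd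
  have hBJ : B + J.card ≤ L ^ (C + 1) :=
    le_trans (by omega) (Nat.pow_le_pow_right hL1 (Nat.le_succ C))
  haveI : NeZero (p ^ K) := ⟨pow_ne_zero _ hp.out.ne_zero⟩
  rw [hy]
  exact hn₀ n (le_trans (le_max_left _ _) hn) c (p ^ K) hcop hKle (B + J.card) lam tab hBJ

end JuntaYoungRank

end Summit.QuantumAdvantage.QuantumAdvantage.Theorems.DigitDial
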